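import Summits.QuantumFields.QCD.Theses.NestedDissectionSea
import Summits.QuantumFields.QCD.Theorems.NestedDissectionSeaKineticEdge

/-!
# Crux `CoerciveSea` (stmt-QuantumFields-13901), line `chirality-collapses-pseudospectrum` —
# the deterministic corner of the hardest stub: below the kinetic edge the chiral pile-up event is EMPTY

Helper file of the line lead for `stub_chiralPileupRareOfPinned` (the A″-law). For the Hermitian
Dirichlet Wilson cell pencil `D_c(μ) u = ev · Γ_c u` (`D_c(μ) = wilsonCell U μ 0 s`, `Γ_c` the
chirality signs `(γ₅)_{αα} = ±1`):

* `level_le_abs_ev_of_eigenvector` — NUMERICAL-RANGE OBSTRUCTION: a unit eigenvector of the pencil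
  on a box of sides `s ≤ N` has `μ + Σ_i (1 − cos(π/s_i)) ≤ |ev|`, because
  `(μ + 4 − Σ cos(π/s_i))·‖u‖² ≤ Re⟨u, D_c u⟩ = Re(ev·χ(u))` (landed kinetic edge
  `KineticEdge.re_quadForm_wilsonCell_ge`) and the chirality `χ(u) = Σ_p conj(u_p)(γ₅)_{α_pα_p}u_p`
  has `‖χ(u)‖ ≤ ‖u‖² = 1`;
* `chiralPileup_empty_of_le_kineticEdge` — hence the A″ event of the stub (verbatim shape, at any
  level `lev` and any threshold `thr ≥ 0`) is EMPTY on every cell with `lev ≤ μ + Σ_i (1 − cos(π/s_i))`: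
  a pile-up `> thr ≥ 0` forces a member, whose eigenvalue is `< lev`;
* `stub4_event_empty_of_le_kineticEdge` — the same at the stub's level `2(t/s₀)` and threshold
  `1/(4(t/s₀))` (registered sub-goal form).

So the A″-law holds trivially (probability `0`) at the bottom of the window, on the cells with
`Σ_i(1 − cos(π/s_i)) ≥ 2t/s₀ − m_f(k)` — the "bottom-of-window cells are deterministically empty"
clause of the stub's docstring, now exact; the open content lives on the kinetically admissible
(mesoscopic) cells only. Chirality is not used: the same obstruction empties the un-split pile-up
event. [folklore]
-/

noncomputable section

open scoped BigOperators Classical ComplexConjugate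
open Matrix Literature.MathematicalPhysics.QuantumLattice Literature.MathematicalPhysics.QuantumFieldTheory
  Literature.Probability.LatticeModels
open Summit.QuantumFields.QCD.Theorems.KineticEdge

namespace Summit.QuantumFields.QCD.Theorems.NestedDissectionSeaCoerciveSea

variable {N : ℕ} [NeZero N]

/-- The chirality signs have modulus one: `‖(γ₅)_{αα}‖ = 1`. [folklore] -/
theorem norm_gammaFive_diag (α : Fin 4) : ‖gammaFive α α‖ = 1 := by
  rw [gammaFive_eq_diagonal, Matrix.diagonal_apply_eq]
  fin_cases α <;> simp

/-- The chirality of a vector on a Wilson box is bounded by its mass: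
`‖Σ_p conj(u_p)(γ₅)_{α_pα_p}u_p‖ ≤ Σ_p ‖u_p‖²` (stated on the box subtype: the index-generic form makes
unification unfold `γ₅`). [folklore] -/
theorem norm_chirality_le (s : Fin 4 → ℕ) (u : {p // wilsonBox (0 : TorusSite 4 N) s p} → ℂ) :
    ‖∑ p, star (u p) * gammaFive p.1.2.2 p.1.2.2 * u p‖ ≤ ∑ p, ‖u p‖ ^ 2 := by
  refine (norm_sum_le _ _).trans (le_of_eq (Finset.sum_congr rfl fun p _ => ?_))
  rw [norm_mul, norm_mul, norm_gammaFive_diag, mul_one, Complex.star_def, Complex.norm_conj, sq]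

/-- The diagonal of an orthonormality relation: `Σ_p conj(u_p) u_p = 1` gives `Σ_p ‖u_p‖² = 1`.
[folklore] -/
theorem sum_norm_sq_eq_one_of_star_mul_self {ι : Type*} [Fintype ι] (u : ι → ℂ)
    (h : ∑ p, star (u p) * u p = 1) : ∑ p, ‖u p‖ ^ 2 = 1 := by
  have hsum : ∑ p, star (u p) * u p = ∑ p, ((‖u p‖ ^ 2 : ℝ) : ℂ) :=
    Finset.sum_congr rfl fun p _ => by rw [Complex.star_def, Complex.conj_mul', Complex.ofReal_pow]
  rw [hsum, ← Complex.ofReal_sum] at h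
  exact_mod_cast h

/-- **Chirality identity**: for an eigenvector of the cell pencil, `Σ_p conj(u_p)(D_c u)_p = ev · χ(u)`.
[folklore] -/
theorem star_mul_cell_eq_ev_mul_chirality (U : GaugeConfig 4 N (Matrix.specialUnitaryGroup (Fin 3) ℂ))
    (μ : ℝ) (s : Fin 4 → ℕ) (u : {p // wilsonBox (0 : TorusSite 4 N) s p} → ℂ) (ev : ℝ)
    (heig : (wilsonCell U μ 0 s).mulVec u = fun p => (ev : ℂ) * gammaFive p.1.2.2 p.1.2.2 * u p) :
    ∑ p, star (u p) * ((wilsonCell U μ 0 s).mulVec u) p =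
      (ev : ℂ) * ∑ p, star (u p) * gammaFive p.1.2.2 p.1.2.2 * u p := by
  rw [heig, Finset.mul_sum]
  refine Finset.sum_congr rfl fun p _ => ?_
  ring

/-- **Numerical-range obstruction for one mode of the cell pencil.** On a box of sides `s ≤ N`, a
unit vector `u` with `D_c(μ) u = ev · Γ_c u` (componentwise `(D_c u)_p = ev (γ₅)_{α_pα_p} u_p`) has
`μ + Σ_i (1 − cos(π/s_i)) ≤ |ev|`: the kinetic edge bounds `Re⟨u, D_c u⟩` below by
`(μ + 4 − Σ cos(π/s_i))‖u‖²`, and `⟨u, D_c u⟩ = ev · χ(u)` with `‖χ(u)‖ ≤ 1`. [folklore] -/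
theorem level_le_abs_ev_of_eigenvector (U : GaugeConfig 4 N (Matrix.specialUnitaryGroup (Fin 3) ℂ))
    (μ : ℝ) (s : Fin 4 → ℕ) (hs : ∀ i, s i ≤ N)
    (u : {p // wilsonBox (0 : TorusSite 4 N) s p} → ℂ) (ev : ℝ)
    (hunit : ∑ p, star (u p) * u p = 1)
    (heig : (wilsonCell U μ 0 s).mulVec u = fun p => (ev : ℂ) * gammaFive p.1.2.2 p.1.2.2 * u p) :
    μ + ∑ i, (1 - Real.cos (Real.pi / s i)) ≤ |ev| := by
  have hn : ∑ p, ‖u p‖ ^ 2 = 1 := sum_norm_sq_eq_one_of_star_mul_self u hunit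
  have h1 := re_quadForm_wilsonCell_ge U μ 0 s hs u
  rw [hn, mul_one] at h1
  have hid : (∑ a, conj (u a) * ((wilsonCell U μ 0 s).mulVec u) a) =
      (ev : ℂ) * ∑ p, star (u p) * gammaFive p.1.2.2 p.1.2.2 * u p :=
    star_mul_cell_eq_ev_mul_chirality U μ s u ev heig
  rw [hid] at h1
  have h2 : ((ev : ℂ) * ∑ p, star (u p) * gammaFive p.1.2.2 p.1.2.2 * u p).re ≤
      |ev| * ‖∑ p, star (u p) * gammaFive p.1.2.2 p.1.2.2 * u p‖ := by
    refine (Complex.re_le_norm _).trans (le_of_eq ?_)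
    rw [norm_mul, Complex.norm_real, Real.norm_eq_abs]
  have h3 : |ev| * ‖∑ p, star (u p) * gammaFive p.1.2.2 p.1.2.2 * u p‖ ≤ |ev| * 1 :=
    mul_le_mul_of_nonneg_left ((norm_chirality_le s u).trans hn.le) (abs_nonneg ev)
  rw [sum_one_sub_cos]
  linarith

/-- **Below the kinetic edge the chiral pile-up event is empty.** If the level `lev` is at most
`μ + Σ_i (1 − cos(π/s_i))` on a box of sides `s ≤ N`, then NO family of unit pencil-eigenvectors with
`|ev_j| < lev` and non-negative weights piles more than a non-negative threshold `thr` — whatever the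
chirality cut `χ₀`: the pile-up `> thr ≥ 0` forces a member `j`, and
`lev ≤ μ + Σ(1 − cos) ≤ |ev_j| < lev`. (The A″ event of `stub_chiralPileupRareOfPinned`, verbatim
shape, with general `lev`, `thr`.) [folklore] -/
theorem chiralPileup_empty_of_le_kineticEdge
    (U : GaugeConfig 4 N (Matrix.specialUnitaryGroup (Fin 3) ℂ)) (μ : ℝ) (s : Fin 4 → ℕ)
    (hs : ∀ i, s i ≤ N) (lev thr χ₀ : ℝ) (hthr : 0 ≤ thr)
    (hlev : lev ≤ μ + ∑ i, (1 - Real.cos (Real.pi / s i))) :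
    ¬ ∃ n : ℕ, ∃ u : Fin n → ({p // wilsonBox (0 : TorusSite 4 N) s p} → ℂ), ∃ ev wgt : Fin n → ℝ,
      (∀ i j, ∑ p, star (u i p) * u j p = if i = j then 1 else 0) ∧
      (∀ j, (wilsonCell U μ 0 s).mulVec (u j) = fun p => (ev j : ℂ) * gammaFive p.1.2.2 p.1.2.2 * u j p) ∧
      (∀ j, |ev j| < lev ∧ 0 ≤ wgt j ∧ wgt j * |ev j| ≤ 1) ∧
      (∀ j, χ₀ ≤ ‖∑ p, star (u j p) * gammaFive p.1.2.2 p.1.2.2 * u j p‖) ∧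
      thr < ∑ j, wgt j * ∑ p, if childrenInterior s p then (0 : ℝ) else ‖u j p‖ ^ 2 := by
  rintro ⟨n, u, ev, wgt, horth, heig, hbd, -, hpile⟩
  -- the pile-up is positive, so the family has a member
  rcases Nat.eq_zero_or_pos n with hn0 | hn
  · subst hn0
    simp only [Finset.univ_eq_empty, Finset.sum_empty] at hpile
    exact absurd hpile (not_lt.mpr hthr)
  · set j : Fin n := ⟨0, hn⟩
    have hunit : ∑ p, star (u j p) * u j p = 1 := by rw [horth j j, if_pos rfl]
    have h1 := level_le_abs_ev_of_eigenvector U μ s hs (u j) (ev j) hunit (heig j)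
    have h2 := (hbd j).1
    linarith

/-- **Registered sub-goal form** (stub `stub4_event_empty_of_le_kineticEdge` of crux
stmt-QuantumFields-13901): at the stub's level `2(t/s₀)` and threshold `1/(4(t/s₀))` with `t > 0`,
the A″ event of `stub_chiralPileupRareOfPinned` is empty on every box `s ≤ N` (with `s₀ ≥ 1`) whose
kinetic edge satisfies `2(t/s₀) ≤ μ + Σ_i (1 − cos(π/s_i))`. [folklore] -/
theorem stub4_event_empty_of_le_kineticEdge :
    ∀ (N : ℕ) [NeZero N] (U : GaugeConfig 4 N (Matrix.specialUnitaryGroup (Fin 3) ℂ)) (μ : ℝ)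
      (s : Fin 4 → ℕ) (t χ₀ : ℝ), (∀ i, s i ≤ N) → 0 < t → 1 ≤ s 0 →
      2 * (t / s 0) ≤ μ + ∑ i, (1 - Real.cos (Real.pi / s i)) →
      ¬ ∃ n : ℕ, ∃ u : Fin n → ({p // wilsonBox (0 : TorusSite 4 N) s p} → ℂ), ∃ ev wgt : Fin n → ℝ,
        (∀ i j, ∑ p, star (u i p) * u j p = if i = j then 1 else 0) ∧
        (∀ j, (wilsonCell U μ 0 s).mulVec (u j) = fun p => (ev j : ℂ) * gammaFive p.1.2.2 p.1.2.2 * u j p) ∧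
        (∀ j, |ev j| < 2 * (t / s 0) ∧ 0 ≤ wgt j ∧ wgt j * |ev j| ≤ 1) ∧
        (∀ j, χ₀ ≤ ‖∑ p, star (u j p) * gammaFive p.1.2.2 p.1.2.2 * u j p‖) ∧
        1 / (4 * (t / s 0)) < ∑ j, wgt j * ∑ p, if childrenInterior s p then (0 : ℝ) else ‖u j p‖ ^ 2 := by
  intro N _ U μ s t χ₀ hs ht hs0 hlev
  have hs0' : (0 : ℝ) < (s 0 : ℝ) := by exact_mod_cast hs0
  have hthr : (0 : ℝ) ≤ 1 / (4 * (t / s 0)) := by positivity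
  exact chiralPileup_empty_of_le_kineticEdge U μ s hs _ _ χ₀ hthr hlev

end Summit.QuantumFields.QCD.Theorems.NestedDissectionSeaCoerciveSea

end
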